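import Literature.NumberTheory.GaloisRepresentations.IdeleBrauerReciprocity
import Literature.NumberTheory.GaloisRepresentations.SemiLocalArchimedeanDecomposition
import Literature.NumberTheory.GaloisCohomology.CorrectionAtPOfCharacterReal
import HarnessLib

/-!
# The archimedean local invariants of a relative Brauer class on the idèles are THE archimedean invariants;
# Tate's reciprocity law `inv (H²(Eˣ → J_E) β) = 0` at a finite layer for EVERY number field
# (Cassels–Fröhlich VII §7.3 Cor. 7.4 (b), §11.2 (bis); Milne *ADT* I Ex. 1.6 (c))

Topic `NumberTheory/GaloisRepresentations`; namespace `Literature.NumberTheory.GaloisRepresentations.IdeleCohomology`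
(sequel to door-c6 g12's `IdeleBrauerReciprocity` — finite places and totally complex base — and
`SemiLocalArchimedeanDecomposition` — `Stab(w₀) ≃* Gal(E_{w₀}/F_v)`, `shapiroArch_infPlaceProj_principal`).  Theorems only; NO
definition, NO named fact, no `sorry`, no instance, no notation; number fields in `Type`.

At an infinite place `v` of `F` (a place `w₀ ∣ v` of `E`, decomposition group `Stab(w₀)` of order `n_v ∈ {1, 2}`), door-c5's
invariant `localInvInfAt w₀ : H²(G, J_E) →+ ℚ/ℤ` is the injection `H²(Stab(w₀), E_{w₀}ˣ) ↪ ℚ/ℤ` of the (cyclic, order-`n_v`)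
archimedean component, and the tree's `archimedeanInvariantMap F n v` on `H²(Γ_{F_v}, μₙ)` (file `ArchimedeanInvariantMap`, Milne
I Ex. 1.6 (c) "the unique injection") is injective at real `v` and zero at complex `v`.  Both values on a relative Brauer class are
`2`-torsion in `ℚ/ℤ`, so they agree as soon as they vanish simultaneously — which is the ARCHIMEDEAN DICTIONARY:

* §1 **`unitsAbsInfTwo_shapiroArch_eq_map`**: in `H²(Γ_{F_v}, F̄_vˣ)`, door-c6's `unitsAbsInfTwo F_v E_{w₀}` of the archimedean
  Shapiro component of `H²(Eˣ → J_E) β` equals the localisation `H²(res_v, ι)` of `unitsAbsInfTwo F E β` (compatible pairs attached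
  to the two `F`-embeddings `E → F̄_v`, `Gal(E/F)`-conjugate; `exists_algEquiv_archEmbedding_eq`); hence
  **`localInvInfAt_brauerToIdele_eq_zero_iff`** (`unitsAbsInfTwo` is injective).
* §2 **`localInvInf_brauerToIdele_eq_canonical`**: `localInvInf E v (brauerToIdele β) = zmodToQmodZ n (LocalInvariants.canonical F n
  (inl v) (loc_v c))` whenever `κ(c) = inf β` (Kummer at `F_v`, `localization_inl_eq_zero_iff_resMu_eq_zero`,
  `archimedeanInvariantMap_injective_of_isReal` / `…_eq_zero_of_isComplex`, `2`-torsion: `eq_of_two_nsmul_eq_zero_of_iff`).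
* §3 **`inv_brauerToIdele_eq_zero`** — TATE'S RECIPROCITY LAW AT A FINITE LAYER FOR EVERY NUMBER FIELD `F`:
  `inv E (brauerToIdele β) = 0` for all `β ∈ H²(Gal(E/F), Eˣ)` (from `sumInvLocalizationEqZero_canonical_of_numberField`, now with
  the archimedean terms matched); `invHom_comp_brauerToIdele`, `inv_eq_zero_of_mem_range_brauerToIdele'`.

HONEST FRAMING: classical class field theory (Tate 1967) in the tree's two dialects; proves no case of BSD; (A4) of Route A for
crux `AnticycControlAdditiveK` (cell bsd-schneider) — `inv = Σ_v inv_v` descends to `H²(G, C_E)` over every base.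

## References
* J. W. S. Cassels, A. Fröhlich (eds.), *Algebraic Number Theory* (1967), Ch. VII (J. Tate) §7.3 Cor. 7.4 (b), §11.2 (bis).
  [CasselsFrohlichANT1967]
* J. S. Milne, *Arithmetic Duality Theorems*, 2nd ed. (2006), Ch. I Ex. 1.6 (c), Thm. 4.10 (b). [MilneADT2006]
* J. Neukirch, A. Schmidt, K. Wingberg, *Cohomology of Number Fields* (2008), Thm. (8.1.17). [NeukirchSchmidtWingberg2008]
-/

noncomputable section

open NumberField NumberField.InfinitePlace IsDedekindDomain CategoryTheory groupCohomology Function Field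
open Literature.NumberTheory.Automorphic
open scoped NumberField.LiesOver

namespace Literature.NumberTheory.GaloisRepresentations

namespace IdeleCohomology

open ArchHerbrand DiscreteGaloisModule Literature.Algebra.Homology Literature.NumberTheory.GaloisCohomology
open Literature.AnabelianGeometry.AbsoluteAnabelian.Prop121vii

variable {F : Type} [Field F] [NumberField F] {E : Type} [Field E] [NumberField E] [Algebra F E] [IsGalois F E]

/-! ## §1. The archimedean dictionary in `H²(Γ_{F_v}, F̄_vˣ)` -/

section Arch

variable (v : InfinitePlace F) (w₀ : InfinitePlace E) [hL : w₀.1.LiesOver v.1]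

/-- `F_v` has characteristic `0`. [cite: CasselsFrohlichANT1967, Ch. II §10] -/
private theorem charZero_completion : CharZero v.Completion :=
  charZero_of_injective_algebraMap (algebraMap F v.Completion).injective

/-- The archimedean local pair `(Γ_{F_v}, F̄_vˣ) → (Gal(E/F), Eˣ)` through the completion `E_{w₀}`: `absUnitsPair F_v E_{w₀}`
composed with `(archDecompIncl, Eˣ ⊆ E_{w₀}ˣ)`; module component `u ↦ ι_{E_{w₀}}(u)`.
[cite: SerreGaloisCohomology1997, Ch. I §2.4][cite: CasselsFrohlichANT1967, Ch. VII §7.2] -/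
theorem archLocalPair_φ_ofMul (u : Eˣ) :
    (haveI := charZero_completion (F := F) v
     haveI := finiteDimensional_completion v w₀
     haveI := isGalois_completion v w₀
     ((absUnitsPair v.Completion w₀.Completion).compMap (archDecompIncl v w₀) (unitsToInfPlaceHom v w₀)).φ
       (Additive.ofMul u)) =
      (haveI := finiteDimensional_completion v w₀; UnitsCarrier.ofUnits
        (Units.map (((embeddingToAbs v.Completion w₀.Completion : w₀.Completion →+* AlgebraicClosure v.Completion).comp
          (algebraMap E w₀.Completion)) : E →* AlgebraicClosure v.Completion) u)) := by
  haveI := charZero_completion (F := F) v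
  haveI := finiteDimensional_completion v w₀
  haveI := isGalois_completion v w₀
  change (absUnitsPair v.Completion w₀.Completion).φ ((unitsToInfPlaceHom v w₀).hom (Additive.ofMul u)) = _
  rw [unitsToInfPlaceHom_hom_ofMul]
  exact (absUnitsPair_φ_ofMul _ _ _).trans (congrArg UnitsCarrier.ofUnits (Units.ext rfl))

/-- **The two `F`-embeddings `E → F̄_v` at an infinite place — `F̄ → F̄_v ∘ ι_E` and `ι_{E_{w₀}} ∘ (E ⊆ E_{w₀})` — differ by an element
of `Gal(E/F)`.** [cite: SerreLocalFields1979, Ch. VII §5 Prop. 3][cite: CasselsFrohlichANT1967, Ch. VII §1.1] -/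
theorem exists_algEquiv_archEmbedding_eq :
    ∃ σ : E ≃ₐ[F] E, ∀ x : E,
      (haveI := finiteDimensional_completion v w₀;
        embeddingToAbs v.Completion w₀.Completion (x : w₀.Completion)) =
        absClosureEmbedding F v.Completion (embeddingToAbs F E (σ x)) := by
  haveI := finiteDimensional_completion v w₀
  let j₁ : E →ₐ[F] AlgebraicClosure v.Completion := (absClosureEmbedding F v.Completion).comp (embeddingToAbs F E)
  let j₂ : E →ₐ[F] AlgebraicClosure v.Completion :=
    { toRingHom := (embeddingToAbs v.Completion w₀.Completion : w₀.Completion →+* AlgebraicClosure v.Completion).comp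
        (algebraMap E w₀.Completion)
      commutes' := fun a => by
        change embeddingToAbs v.Completion w₀.Completion (algebraMap F w₀.Completion a) = _
        rw [IsScalarTower.algebraMap_apply F v.Completion w₀.Completion, AlgHom.commutes,
          ← IsScalarTower.algebraMap_apply] }
  letI : Algebra E (AlgebraicClosure v.Completion) := (j₁ : E →+* _).toAlgebra
  haveI : IsScalarTower F E (AlgebraicClosure v.Completion) := IsScalarTower.of_algebraMap_eq fun a => (j₁.commutes a).symm
  refine ⟨j₂.restrictNormal' E, fun x => ?_⟩
  have h := AlgHom.restrictNormal_commutes j₂ E x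
  rw [Algebra.algebraMap_self, RingHom.id_apply] at h
  exact h.symm

/-- **THE ARCHIMEDEAN DICTIONARY in `H²(Γ_{F_v}, F̄_vˣ)`**: `unitsAbsInfTwo F_v E_{w₀}` of the archimedean Shapiro component of
`H²(Eˣ → J_E) β` (through `Stab(w₀) ≃ Gal(E_{w₀}/F_v)`) is the localisation `H²(res_v, ι)` of the inflated class
`unitsAbsInfTwo F E β`, for every standard units morphism `ι`. [cite: CasselsFrohlichANT1967, Ch. VII §7.3 Cor. 7.4 (b)]
[cite: SerreLocalFields1979, Ch. XI §2 Prop. 1] -/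
theorem unitsAbsInfTwo_shapiroArch_eq_map
    (φ : TopRep.res ((absGaloisRestrict F v.Completion : absoluteGaloisGroup v.Completion →ₜ* absoluteGaloisGroup F) :
        absoluteGaloisGroup v.Completion →* absoluteGaloisGroup F) (units F).toTopRep ⟶ (units v.Completion).toTopRep)
    (hφ : ∀ u : (AlgebraicClosure F)ˣ, φ.hom (UnitsCarrier.ofUnits u) =
      UnitsCarrier.ofUnits (Units.map (absClosureEmbedding F v.Completion : AlgebraicClosure F →* AlgebraicClosure v.Completion) u))
    (β : groupCohomology (Rep.ofAlgebraAutOnUnits F E) 2) :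
    (haveI := charZero_completion (F := F) v
     haveI := finiteDimensional_completion v w₀
     haveI := isGalois_completion v w₀
     unitsAbsInfTwo v.Completion w₀.Completion
      ((groupCohomologyArchLocalUnitsRepIsoAut v w₀ 2).hom ((groupCohomologyArchUnitsRepIso (F := F) w₀ 2).hom
        (groupCohomology.map (MonoidHom.id (E ≃ₐ[F] E)) (infPlaceProj (E := E) (w₀.comap (algebraMap F E))) 2
          (brauerToIdele F E β))))) =
      (ContinuousCohomology.map (absGaloisRestrict F v.Completion) φ 2).hom (unitsAbsInfTwo F E β) := by
  haveI := charZero_completion (F := F) v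
  haveI := finiteDimensional_completion v w₀
  haveI := isGalois_completion v w₀
  haveI : CompactSpace (absoluteGaloisGroup v.Completion) := absoluteGaloisGroup_compactSpace _
  have hSh := congrArg (fun T => (ConcreteCategory.hom T) β) (shapiroArch_infPlaceProj_principal v w₀ 2)
  simp only [ModuleCat.hom_comp, LinearMap.coe_comp, Function.comp_apply] at hSh
  rw [brauerToIdele_apply, hSh]
  induction β using H2_induction_on with
  | h b =>
  rw [H2π_comp_map_apply, unitsAbsInfTwo_H2π, CompatiblePair.pull_mapCocycles₂, map_unitsAbsInfTwo_H2π]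
  obtain ⟨σ, hσ⟩ := exists_algEquiv_archEmbedding_eq (F := F) (E := E) v w₀
  exact CompatiblePair.twoCocycleClass_pull_eq_of_ringHom_eq_comp v.Completion
    ((absUnitsPair F E).pullback (absGaloisRestrict F v.Completion) φ) _
    (((absClosureEmbedding F v.Completion : AlgebraicClosure F →+* AlgebraicClosure v.Completion).comp
      (embeddingToAbs F E : E →+* AlgebraicClosure F)))
    ((embeddingToAbs v.Completion w₀.Completion : w₀.Completion →+* AlgebraicClosure v.Completion).comp
      (algebraMap E w₀.Completion))
    σ (pullback_absUnitsPair_φ_ofMul F E v.Completion φ hφ) (archLocalPair_φ_ofMul v w₀) hσ b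

/-- **`localInvInfAt w₀ (brauerToIdele β) = 0 ↔ loc_v (inf β) = 0` in `H²(Γ_{F_v}, F̄_vˣ)`** (door-c5's archimedean invariant is
injective on the archimedean component; the Shapiro isomorphisms and `unitsAbsInfTwo` are injective).
[cite: CasselsFrohlichANT1967, Ch. VII §7.3 Cor. 7.4 (b)] -/
theorem localInvInfAt_brauerToIdele_eq_zero_iff
    (φ : TopRep.res ((absGaloisRestrict F v.Completion : absoluteGaloisGroup v.Completion →ₜ* absoluteGaloisGroup F) :
        absoluteGaloisGroup v.Completion →* absoluteGaloisGroup F) (units F).toTopRep ⟶ (units v.Completion).toTopRep)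
    (hφ : ∀ u : (AlgebraicClosure F)ˣ, φ.hom (UnitsCarrier.ofUnits u) =
      UnitsCarrier.ofUnits (Units.map (absClosureEmbedding F v.Completion : AlgebraicClosure F →* AlgebraicClosure v.Completion) u))
    (β : groupCohomology (Rep.ofAlgebraAutOnUnits F E) 2) :
    localInvInfAt (F := F) w₀ (brauerToIdele F E β) = 0 ↔
      (ContinuousCohomology.map (absGaloisRestrict F v.Completion) φ 2).hom (unitsAbsInfTwo F E β) = 0 := by
  haveI := charZero_completion (F := F) v
  haveI := finiteDimensional_completion v w₀
  haveI := isGalois_completion v w₀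
  rw [localInvInfAt_eq_zero_iff, ← unitsAbsInfTwo_shapiroArch_eq_map v w₀ φ hφ β]
  constructor
  · intro h
    rw [h, map_zero, map_zero, map_zero]
    rfl
  · intro h
    have h1 := unitsAbsInfTwo_injective v.Completion w₀.Completion (h.trans (map_zero _).symm)
    have h2 := (groupCohomologyArchLocalUnitsRepIsoAut v w₀ 2).toLinearEquiv.injective (h1.trans (map_zero _).symm)
    exact (groupCohomologyArchUnitsRepIso (F := F) w₀ 2).toLinearEquiv.injective (h2.trans (map_zero _).symm)

end Arch

/-! ## §2. The archimedean invariants through THE canonical family -/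

/-- Two `2`-torsion elements of `ℚ/ℤ` that vanish simultaneously are equal (`ℚ/ℤ[2] = {0, ½}`).
[cite: MilneADT2006, Ch. I, Ex. 1.6 (c)] -/
theorem eq_of_two_nsmul_eq_zero_of_iff {t₁ t₂ : AddCircle (1 : ℚ)} (h₁ : 2 • t₁ = 0) (h₂ : 2 • t₂ = 0)
    (h : t₁ = 0 ↔ t₂ = 0) : t₁ = t₂ := by
  by_cases ht : t₁ = 0
  · rw [ht, eq_comm]; exact h.1 ht
  · rw [eq_zmodToQmodZ_two_one h₁ ht, eq_zmodToQmodZ_two_one h₂ (fun h' => ht (h.2 h'))]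

variable {n : ℕ} [NeZero n]

/-- **The archimedean dictionary to THE canonical family**: if `κ(c) = inf β` then door-c5's invariant of `β` at the infinite place
`v` is `(1/n) · inv_v (loc_v c)` with `inv_v = LocalInvariants.canonical F n (inl v) = archimedeanInvariantMap F n v`.
[cite: CasselsFrohlichANT1967, Ch. VII §7.3 Cor. 7.4 (b)][cite: MilneADT2006, Ch. I, Ex. 1.6 (c)] -/
theorem localInvInf_brauerToIdele_eq_canonical (β : groupCohomology (Rep.ofAlgebraAutOnUnits F E) 2)
    (c : galoisCohomology (mu F n) 2) (hc : cohomologyMap (kummerι F n) 2 c = unitsAbsInfTwo F E β) (v : InfinitePlace F) :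
    localInvInf E v (brauerToIdele F E β) =
      zmodToQmodZ n (LocalInvariants.canonical F n (Sum.inl v) (galoisCohomology.localization (mu F n) (Sum.inl v) 2 c)) := by
  rcases v.isReal_or_isComplex with hvr | hvc
  swap
  · rw [localInvInf_eq_zero_of_isComplex hvc, LocalInvariants.canonical_inl_eq_zero_of_isComplex hvc, map_zero]
  have hv : (placeOver E v).comap (algebraMap F E) = v := isOver_placeOver (E := E) v
  haveI : (placeOver E v).1.LiesOver v.1 := ⟨congrArg Subtype.val hv⟩
  obtain ⟨φ, hφ⟩ := exists_unitsHom (F := F) v.Completion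
  -- the two vanishing statements agree
  have hiff : localInvInf E v (brauerToIdele F E β) = 0 ↔
      galoisCohomology.localization (mu F n) (Sum.inl v) 2 c = 0 := by
    change localInvInfAt (F := F) (placeOver E v) (brauerToIdele F E β) = 0 ↔ _
    rw [localInvInfAt_brauerToIdele_eq_zero_iff v (placeOver E v) φ hφ β, localization_inl_eq_zero_iff_resMu_eq_zero]
    have hk : cohomologyMap (kummerι v.Completion n) 2 (resMu F v.Completion n 2 c) =
        (ContinuousCohomology.map (absGaloisRestrict F v.Completion) φ 2).hom (unitsAbsInfTwo F E β) := by
      rw [← hc]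
      exact cohomologyMap_kummerι_resMu F v.Completion n φ hφ 2 c
    constructor
    · intro h
      exact kummer_injective v.Completion n (hk.trans (h.trans (map_zero _).symm))
    · intro h
      rw [← hk, h]
      exact (cohomologyMap (kummerι v.Completion n) 2).hom.map_zero
  -- both sides are `2`-torsion
  have h2l : 2 • localInvInf E v (brauerToIdele F E β) = 0 := by
    have h := infLocalDegree_nsmul_localInvInf (E := E) v (brauerToIdele F E β)
    rcases infLocalDegree_eq_one_or_two (E := E) v with h1 | h2
    · rw [h1, one_smul] at h
      rw [h, smul_zero]
    · rwa [h2] at h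
  have h2r : 2 • zmodToQmodZ n (LocalInvariants.canonical F n (Sum.inl v)
      (galoisCohomology.localization (mu F n) (Sum.inl v) 2 c)) = 0 := by
    rw [← map_nsmul, LocalInvariants.canonical_inl, two_nsmul_archimedeanInvariantMap, map_zero]
  refine eq_of_two_nsmul_eq_zero_of_iff h2l h2r (hiff.trans ?_)
  rw [← map_zero (zmodToQmodZ n), (zmodToQmodZ_injective n).eq_iff, LocalInvariants.canonical_inl,
    ← map_zero (archimedeanInvariantMap F n v), (archimedeanInvariantMap_injective_of_isReal hvr).eq_iff]

/-! ## §3. Tate's reciprocity law at a finite layer, every number field -/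

/-- **TATE'S RECIPROCITY LAW AT A FINITE LAYER: the local invariants of a relative Brauer class sum to zero**,
`inv E (H²(Eˣ → J_E) β) = 0` for every `β ∈ H²(Gal(E/F), Eˣ)` and EVERY number field `F` — from the tree's absolute law
`Σ_v inv_v (loc_v c) = 0` on `H²(Γ_F, μₙ)` for THE canonical invariant maps, through Kummer and the dictionary at all places.
[cite: CasselsFrohlichANT1967, Ch. VII §11.2 (bis)][cite: NeukirchSchmidtWingberg2008, Thm. (8.1.17)] -/
theorem inv_brauerToIdele_eq_zero (β : groupCohomology (Rep.ofAlgebraAutOnUnits F E) 2) :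
    inv E (brauerToIdele F E β) = 0 := by
  classical
  obtain ⟨n, hn⟩ : ∃ n : ℕ, n = Nat.card (E ≃ₐ[F] E) := ⟨_, rfl⟩
  haveI : NeZero n := ⟨by rw [hn]; exact Nat.card_pos.ne'⟩
  have hz : (n : ℤ) • unitsAbsInfTwo F E β = 0 := by rw [hn]; exact natCard_zsmul_unitsAbsInfTwo_eq_zero β
  obtain ⟨c, hc⟩ := exists_kummer_eq_of_nsmul_eq_zero F n _ hz
  obtain ⟨T, hT⟩ := exists_finset_forall_localInv_eq_zero (E := E) (brauerToIdele F E β)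
  have hzero : ∀ v : Place F, v ∉ (Finset.univ : Finset (InfinitePlace F)).disjSum T →
      LocalInvariants.canonical F n v (galoisCohomology.localization (mu F n) v 2 c) = 0 := by
    rintro (w | v) hv
    · exact absurd (Finset.inl_mem_disjSum.2 (Finset.mem_univ w)) hv
    · have hvT : v ∉ T := fun h => hv (Finset.inr_mem_disjSum.2 h)
      exact (localInv_brauerToIdele_eq_zero_iff β c hc v).1 (hT v hvT)
  have hsum := sumInvLocalizationEqZero_canonical_of_numberField (K := F) n c _ hzero
  rw [Finset.sum_disjSum] at hsum
  rw [inv_eq_sum (brauerToIdele F E β) T hT]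
  simp_rw [localInv_brauerToIdele_eq_canonical β c hc, localInvInf_brauerToIdele_eq_canonical β c hc]
  rw [← map_sum, ← map_sum, ← map_add, add_comm, hsum, map_zero]

/-- **`inv ∘ H²(Eˣ → J_E) = 0`** as additive maps, every base field. [cite: CasselsFrohlichANT1967, Ch. VII §11.2 (bis)] -/
theorem invHom_comp_brauerToIdele :
    (invHom (F := F) (E := E)).comp (brauerToIdele F E).hom.toAddMonoidHom = 0 :=
  AddMonoidHom.ext fun β => inv_brauerToIdele_eq_zero β

/-- Element form: every class in the image of `Br(E/F) → H²(G, J_E)` has `inv = 0`, every base field.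
[cite: CasselsFrohlichANT1967, Ch. VII §11.2 (bis)] -/
theorem inv_eq_zero_of_mem_range_brauerToIdele' {x : groupCohomology (IdeleClassGroup.ideleRep F E) 2}
    (hx : x ∈ Set.range (brauerToIdele F E)) : inv E x = 0 := by
  obtain ⟨β, rfl⟩ := hx
  exact inv_brauerToIdele_eq_zero β

end IdeleCohomology

end Literature.NumberTheory.GaloisRepresentations

end
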